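import Summits.ResolutionOfSingularities.ResolutionOfSingularities.Theorems.WildConesCampaignW46FormalChartAssembly
import Summits.ResolutionOfSingularities.ResolutionOfSingularities.Theorems.WildConesCampaignW46AtomGerm
import HarnessLib

/-!
# [OURS · L1 W4.6, rungs (i)/(ii) — the dictionary, SCHEME HALF, brick 8 = (S1) at the ring level] The controlled
# transform of an atom `z^p = a(u)` at a rational point of the point blow-up is the SUCCESSOR atom
# `z^p = (ser (step i τ c))(u)` in recognised formal coordinates

Cell res-hironaka (LADDER-RESOLUTION rung L, D-0089), slot W4.6, seat res-L1-s46-pv-2 (gen 2). Host: route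
`WildCones`, crux `ClassicalRegimes` (stmt-ResolutionOfSingularities-16884), `--supports … --as helper`.

HONEST FRAMING. Everything here is OURS: it composes bricks 1–5 (`…FormalChart`, `…AtomGerm`,
`…FormalChartAssembly`) — ordinary commutative algebra about route `WildCones`' coefficient calculus
(`Theorems/WildConesClassicalRegimesDefs.lean`: `ser`, `step`, `MultP`) and the formal dictionary
(`Theorems/WildConesCampaignW46FormalDictionary.lean`: `cleaningShift`, `moveSer`). NOTHING here is a statement of
H. Hironaka's manuscript [Hironaka2017]; no FACT-LIST premise. AI review is weaker than expert review.

## Statement (`exists_ringEquiv_transform_atom`)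

Ring-level data (supplied at the stalks of the typed blow-up by bricks 6/7, `…StalkChart`, `…RationalPoint`):
a local homomorphism `g : R → L` of Noetherian local rings, formal coordinates
`E₀ : R̂ ≅ κ⟦z,u⟧ = MvPowerSeries (Option (Fin n)) κ` adapted to generators `c` of `𝔪_R` to first order, a chart index
`i = some i₀` (a `u`-chart), quotients `e_j`, lifts `τ̃_j` with `𝔪_L = (g cᵢ) + (e_j − g τ̃_j)`, residual rationality,
`n + 1 ≤ dim L`; and the ATOM: `E₀(f₀) = w₀ · (z^p − ser c₀)`, `w₀` a unit, `c₀` a state of multiplicity `p` over the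
perfect field `κ` of characteristic `p`; and its controlled transform `f′` at `L`: `g(f₀) = g(cᵢ)^p · f′` with
`f′ ∈ 𝔪_L` (the point lies on the transform). Let `τ_j ∈ κ` be the constant term of `E₀(τ̃_{some j})`.

**Then** there are `E′ : L̂ ≅ κ⟦z,u⟧`, fixing constants along `ĝ ∘ E₀⁻¹`, and a unit `w′` with
`E′(f′) = w′ · (z^p − ser (step i₀ τ c₀))`: the controlled transform is the atom of the SUCCESSOR STATE of route
`WildCones`' dynamics, in formal coordinates at the new point in which `π̂^♯` is the germ chart substitution `Ψ̂`
(chart `u_{i₀}`, point `τ`, cleaning shift `r`).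

Proof: brick 5 gives `E` with `E ∘ ĝ ∘ E₀⁻¹ = σ_{i,(ζ,τ)}`, `ζ` the constant term of `E₀(τ̃_none)`; then
`E(g f₀) = (unit) · uᵢ^p · ((z + ζ)^p − T)`, `T` the total transform series, and `E(g cᵢ) = uᵢ · (unit)` (first-order
adaptation), so `E(f′) = (unit) · ((z + ζ)^p − T)`; `f′ ∈ 𝔪` forces `ζ^p = T(0) = r(0)^p`, i.e. `ζ = r(0)` (Frobenius
is injective); the shear by `s = r − r(0)` (brick 5, `_shear`) then produces `E′` with `E′ ∘ ĝ ∘ E₀⁻¹ = Ψ̂`, and brick 2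
(`AtomGerm.ringHom_atom_eq`) gives `E′(g f₀) = (unit) · uᵢ^p · (z^p − ser (step i₀ τ c₀))`.

References: bricks 1–7 of this seat; route file `Theses/WildCones.lean` (crux `ClassicalRegimes`: «the dictionary
state ↦ local ring of the strict transform»); H. Hironaka, ms. 2017, Th. 16.6 p.84, Def. 2.1 p.5 — ROLE of «the
transform `E′` of `E` by the blowup `π`» only, under adjudication, not cited as fact. [folklore]
-/

noncomputable section

-- single-problem summit: the doubled namespace component `ResolutionOfSingularities` is forced
set_option linter.dupNamespace false

open scoped BigOperators Classical
open MvPowerSeries IsLocalRing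

namespace Summit.ResolutionOfSingularities.ResolutionOfSingularities.Theorems

namespace CampaignW46.AtomGerm

open WildCones
open CampaignW46.FormalDictionary
open CampaignW46.FormalChart
open Summit.ResolutionOfSingularities.ResolutionOfSingularities.Theorems.FrobeniusClosing (chartSubst)
open Literature.AlgebraicGeometry.Resolution
open Literature.RingTheory.MvPowerSeries.Jets (maximalIdeal_pow_eq_span_monomial
  mem_maximalIdeal_iff_constantCoeff_eq_zero)

variable {n : ℕ} {κ : Type} [Field κ] {p : ℕ}

/-! ## Substitutions whose values are divisible by one variable -/

/-- A substitution all of whose values are multiples of `x` takes a monomial of degree `k` into `(x)^k`.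
[folklore] -/
theorem subst_monomial_mem_span_pow {ι : Type} [Fintype ι] {a : ι → MvPowerSeries (Option (Fin n)) κ}
    (ha : HasSubst a) {x : MvPowerSeries (Option (Fin n)) κ} (hax : ∀ j, a j ∈ Ideal.span {x}) (e : ι →₀ ℕ) :
    subst a (monomial e (1 : κ)) ∈ Ideal.span {x} ^ e.degree := by
  rw [subst_monomial ha, map_one, one_mul, Finsupp.prod, Finsupp.degree_apply, ← Finset.prod_pow_eq_pow_sum]
  exact Ideal.prod_mem_prod fun j _ => Ideal.pow_mem_pow (hax j) _

/-- A substitution all of whose values are multiples of `x` takes `𝔪^k` into `(x^k)`. [folklore] -/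
theorem subst_mem_span_pow_of_mem_maximalIdeal_pow {ι : Type} [Fintype ι] {a : ι → MvPowerSeries (Option (Fin n)) κ}
    (ha : HasSubst a) {x : MvPowerSeries (Option (Fin n)) κ} (hax : ∀ j, a j ∈ Ideal.span {x}) {k : ℕ}
    {h : MvPowerSeries ι κ} (hh : h ∈ maximalIdeal (MvPowerSeries ι κ) ^ k) :
    subst a h ∈ Ideal.span {x ^ k} := by
  rw [maximalIdeal_pow_eq_span_monomial] at hh
  rw [← Ideal.span_singleton_pow]
  induction hh using Submodule.span_induction with
  | mem y hy =>
    obtain ⟨e, he, rfl⟩ := hy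
    have := subst_monomial_mem_span_pow ha hax e
    rwa [show e.degree = k from he] at this
  | zero => rw [← substAlgHom_apply ha, map_zero]; exact Ideal.zero_mem _
  | add y z _ _ hy hz => rw [← substAlgHom_apply ha, map_add, substAlgHom_apply, substAlgHom_apply]; exact Ideal.add_mem _ hy hz
  | smul b y _ hy =>
    rw [smul_eq_mul, ← substAlgHom_apply ha, map_mul, substAlgHom_apply, substAlgHom_apply]
    exact Ideal.mul_mem_left _ _ hy

/-! ## Constant terms -/

/-- The constant term of the cleaning shift to the `p` is the constant term of the total-transform series.
[folklore] -/
theorem constantCoeff_cleaningShift_pow [Fact p.Prime] [CharP κ p] [PerfectField κ] (c : (Fin n → ℕ) → κ)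
    (i : Fin n) (τ : Fin n → κ) :
    constantCoeff (cleaningShift p n κ c i τ) ^ p = constantCoeff (moveSer p n κ c i τ) := by
  rw [← map_pow, cleaningShift_pow, ← coeff_zero_eq_constantCoeff_apply, coeff_pPowPart, if_pos,
    coeff_zero_eq_constantCoeff_apply]
  intro j
  exact dvd_zero p

/-- A variable is not zero. [folklore] -/
theorem X_some_ne_zero (i : Fin n) : (X (some i) : MvPowerSeries (Option (Fin n)) κ) ≠ 0 := by
  intro h
  have := congrArg (coeff (Finsupp.single (some i) 1)) h
  rw [coeff_X, if_pos rfl, map_zero] at this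
  exact one_ne_zero this

/-! ## The transform of the atom at a rational point -/

section Transform

variable [Fact p.Prime] [CharP κ p] [PerfectField κ]
  {R : Type} [CommRing R] [IsLocalRing R] [IsNoetherianRing R]
  {L : Type} [CommRing L] [IsLocalRing L] [IsNoetherianRing L]
  (g : R →+* L) (hg : (maximalIdeal R).map g ≤ maximalIdeal L)
  (E₀ : AdicCompletion (maximalIdeal R) R ≃+* MvPowerSeries (Option (Fin n)) κ)
  (c : Option (Fin n) → R) (hc : Ideal.span (Set.range c) = maximalIdeal R)
  (hcX : ∀ j, E₀ (algebraMap R (AdicCompletion (maximalIdeal R) R) (c j)) - X j ∈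
    maximalIdeal (MvPowerSeries (Option (Fin n)) κ) ^ 2)
  (i₀ : Fin n) (e : Option (Fin n) → L) (he : ∀ j, g (c j) = g (c (some i₀)) * e j)
  (τ : Option (Fin n) → R)
  (hgen : Ideal.span (Set.range fun j : Option (Fin n) =>
    if j = some i₀ then g (c (some i₀)) else e j - g (τ j)) = maximalIdeal L)
  (hres : ∀ y : L, ∃ r : R, y - g r ∈ maximalIdeal L)
  (hdim : (Fintype.card (Option (Fin n)) : WithBot ℕ∞) ≤ ringKrullDim L)

omit [PerfectField κ] in
/-- Under a substitution whose values are multiples of `X (some i₀)` and which fixes `X (some i₀)`, a series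
adapted to the formal coordinate `X (some i₀)` to first order goes to `X (some i₀)` times a unit. [folklore] -/
theorem exists_isUnit_image_adapted {a : Option (Fin n) → MvPowerSeries (Option (Fin n)) κ} (ha : HasSubst a)
    (hai : a (some i₀) = X (some i₀)) (hax : ∀ j, a j ∈ Ideal.span {(X (some i₀) : MvPowerSeries (Option (Fin n)) κ)})
    (x : MvPowerSeries (Option (Fin n)) κ)
    (hx : x - X (some i₀) ∈ maximalIdeal (MvPowerSeries (Option (Fin n)) κ) ^ 2) :
    ∃ w : MvPowerSeries (Option (Fin n)) κ, IsUnit w ∧ subst a x = X (some i₀) * w := by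
  obtain ⟨b, hb⟩ := Ideal.mem_span_singleton'.1 (subst_mem_span_pow_of_mem_maximalIdeal_pow ha hax hx)
  refine ⟨1 + X (some i₀) * b, ?_, ?_⟩
  · rw [MvPowerSeries.isUnit_iff_constantCoeff, map_add, map_one, map_mul, constantCoeff_X, zero_mul, add_zero]
    exact isUnit_one
  · have h1 : subst a x = subst a (x - X (some i₀)) + subst a (X (some i₀) : MvPowerSeries (Option (Fin n)) κ) := by
      rw [← substAlgHom_apply ha, ← substAlgHom_apply ha, ← substAlgHom_apply ha, ← map_add, sub_add_cancel]
    rw [h1, ← hb, subst_X ha, hai]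
    ring

include hc he hcX hgen hres hdim in
/-- [OURS · L1 W4.6 — DICTIONARY, SCHEME HALF, brick 8 = (S1) AT THE RING LEVEL; replaces the role of «the transform
`E′` of `E` by the blowup `π` with center `D`» (H. Hironaka, ms. 2017, Th. 16.6 p.84, Def. 2.1 p.5) for an ATOM
`z^p = a(u)` at a rational point of the point blow-up; NOT a statement of the manuscript] **The controlled transform
of the atom is the successor atom.** See the module docstring. [folklore] -/
theorem exists_ringEquiv_transform_atom (c₀ : (Fin n → ℕ) → κ) (hM : MultP p n κ c₀) (f₀ : R)
    (w₀ : MvPowerSeries (Option (Fin n)) κ) (hw₀ : IsUnit w₀)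
    (hf₀ : E₀ (algebraMap R (AdicCompletion (maximalIdeal R) R) f₀) =
      w₀ * ((X none : MvPowerSeries (Option (Fin n)) κ) ^ p - rename (some : Fin n → Option (Fin n)) (ser p n κ c₀)))
    (f' : L) (hf' : g f₀ = g (c (some i₀)) ^ p * f') (hf'𝔪 : f' ∈ maximalIdeal L) :
    ∃ (E' : AdicCompletion (maximalIdeal L) L ≃+* MvPowerSeries (Option (Fin n)) κ)
      (w' : MvPowerSeries (Option (Fin n)) κ), IsUnit w' ∧
      (∀ l, E' (((adicCompletionMap (maximalIdeal R) (maximalIdeal L) g hg).comp E₀.symm.toRingHom)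
        (MvPowerSeries.C l)) = MvPowerSeries.C l) ∧
      E' (algebraMap L (AdicCompletion (maximalIdeal L) L) f') =
        w' * ((X none : MvPowerSeries (Option (Fin n)) κ) ^ p -
          rename (some : Fin n → Option (Fin n)) (ser p n κ (step p n κ i₀
            (fun j : Fin n => constantCoeff (E₀ (algebraMap R (AdicCompletion (maximalIdeal R) R) (τ (some j)))))
            c₀))) := by
  -- notation
  set ĝ := adicCompletionMap (maximalIdeal R) (maximalIdeal L) g hg with hĝ
  set φ : MvPowerSeries (Option (Fin n)) κ →+* AdicCompletion (maximalIdeal L) L := ĝ.comp E₀.symm.toRingHom with hφ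
  set ofL := algebraMap L (AdicCompletion (maximalIdeal L) L) with hofL
  set ofR := algebraMap R (AdicCompletion (maximalIdeal R) R) with hofR
  set τκ : Fin n → κ := fun j => constantCoeff (E₀ (ofR (τ (some j)))) with hτκ
  set ζ : κ := constantCoeff (E₀ (ofR (τ none))) with hζ
  set r := cleaningShift p n κ c₀ i₀ τκ with hr
  set T := moveSer p n κ c₀ i₀ τκ with hT
  set a₀ := ser p n κ c₀ with ha₀
  have hφE₀ : ∀ x, φ (E₀ x) = ĝ x := fun x => by
    rw [hφ, RingHom.comp_apply]
    change ĝ (E₀.symm (E₀ x)) = ĝ x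
    rw [RingEquiv.symm_apply_apply]
  have hĝ_of : ∀ x : R, ĝ (ofR x) = ofL (g x) := fun x => by
    rw [hofR, hofL, hĝ, adicCompletionMap_algebraMap]
  have hτ' : ∀ j : Option (Fin n), constantCoeff (E₀ (ofR (τ j))) = (j.elim ζ τκ : κ) := by
    intro j; cases j with
    | none => rfl
    | some k => rfl
  haveI : IsNoetherianRing (AdicCompletion (maximalIdeal L) L) := isNoetherianRing_adicCompletion_maximalIdeal L
  -- STEP 1: the plain chart `E`
  obtain ⟨E, hEC, hEi, hEj⟩ :=
    exists_ringEquiv_completion_chart g hg E₀ c hc hcX (some i₀) e he τ hgen hres hdim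
  -- `E ∘ φ` is the substitution `σ`: `X_j ↦ X_i (X_j + τ'_j)`
  set σ : Option (Fin n) → MvPowerSeries (Option (Fin n)) κ := fun j =>
    if j = some i₀ then X (some i₀) else X (some i₀) * (X j + MvPowerSeries.C (j.elim ζ τκ)) with hσ
  have hσsub : HasSubst σ := hasSubst_chart (some i₀) (fun j : Option (Fin n) => (j.elim ζ τκ : κ))
  have hEφ : ∀ f, E (φ f) = subst σ f := by
    intro f
    refine ringHom_eq_subst_of_apply_X ((E : _ →+* MvPowerSeries (Option (Fin n)) κ).comp φ) hEC (some i₀)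
      (fun j : Option (Fin n) => (j.elim ζ τκ : κ)) hEi (fun j hj => ?_) f
    rw [RingHom.comp_apply]
    change E (φ (X j)) = _
    rw [hEj j hj, hτ' j]
  have hσi : σ (some i₀) = X (some i₀) := by rw [hσ]; simp
  have hσX : ∀ j, σ j ∈ Ideal.span {(X (some i₀) : MvPowerSeries (Option (Fin n)) κ)} := by
    intro j
    by_cases hj : j = some i₀
    · rw [hσ]; simp only [hj, if_true]; exact Ideal.subset_span rfl
    · rw [hσ]; simp only [if_neg hj]; exact Ideal.mul_mem_right _ _ (Ideal.subset_span rfl)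
  -- `σ` on placed `u`-series is the placed `u`-chart substitution
  have hσren : ∀ q : MvPowerSeries (Fin n) κ, subst σ (rename (some : Fin n → Option (Fin n)) q) =
      rename (some : Fin n → Option (Fin n)) (subst (chartSubst n κ i₀ τκ) q) := by
    intro q
    rw [rename_some_eq_subst q, subst_comp_subst_apply hasSubst_X_some hσsub,
      rename_some_eq_subst (subst (chartSubst n κ i₀ τκ) q),
      subst_comp_subst_apply (FrobeniusClosing.FactorizationProof.hasSubst_chartSubst i₀ τκ) hasSubst_X_some]
    congr 1
    funext j
    rw [subst_X hσsub, ← rename_some_eq_subst]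
    by_cases hj : j = i₀
    · subst hj; rw [rename_chartSubst_self, hσ]; simp
    · rw [rename_chartSubst_of_ne i₀ τκ hj, hσ]
      simp [hj]
  -- STEP 2: `E (g f₀) = σ(w₀) · X_i^p · Q`, `Q = (z + ζ)^p − T`
  set Q : MvPowerSeries (Option (Fin n)) κ :=
    (X none + MvPowerSeries.C ζ) ^ p - rename (some : Fin n → Option (Fin n)) T with hQ
  have hEatom : E (φ ((X none : MvPowerSeries (Option (Fin n)) κ) ^ p - rename (some : Fin n → Option (Fin n)) a₀)) =
      X (some i₀) ^ p * Q := by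
    rw [hEφ, ← substAlgHom_apply hσsub, map_sub, map_pow, substAlgHom_apply, substAlgHom_apply, subst_X hσsub,
      hσren, ha₀, subst_chartSubst_ser c₀ i₀ τκ hM, map_mul, map_pow, rename_X, hQ, ← hT]
    have hσnone : σ none = X (some i₀) * (X none + MvPowerSeries.C ζ) := by rw [hσ]; simp
    rw [hσnone, mul_pow]
    ring
  have hEgf₀ : E (ofL (g f₀)) = subst σ w₀ * (X (some i₀) ^ p * Q) := by
    rw [← hĝ_of, ← hφE₀, hf₀, map_mul, map_mul, hEatom, hEφ]
  -- STEP 3: `E (g cᵢ) = X_i · unit`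
  obtain ⟨w₁, hw₁, hEci⟩ : ∃ w₁ : MvPowerSeries (Option (Fin n)) κ, IsUnit w₁ ∧
      E (ofL (g (c (some i₀)))) = X (some i₀) * w₁ := by
    obtain ⟨w₁, hw₁, h⟩ := exists_isUnit_image_adapted i₀ hσsub hσi hσX (E₀ (ofR (c (some i₀)))) (hcX (some i₀))
    exact ⟨w₁, hw₁, by rw [← hĝ_of, ← hφE₀, hEφ, h]⟩
  -- STEP 4: `E f′ = unit · Q`, hence `Q ∈ 𝔪`, hence `ζ = r(0)`
  have hw₀' : IsUnit (subst σ w₀) := by rw [← substAlgHom_apply hσsub]; exact hw₀.map _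
  have hEf' : w₁ ^ p * E (ofL f') = subst σ w₀ * Q := by
    have h1 : E (ofL (g f₀)) = (X (some i₀) * w₁) ^ p * E (ofL f') := by
      rw [hf', map_mul, map_pow, map_mul, map_pow, hEci]
    have h2 : (X (some i₀) : MvPowerSeries (Option (Fin n)) κ) ^ p * (w₁ ^ p * E (ofL f')) =
        X (some i₀) ^ p * (subst σ w₀ * Q) := by
      rw [← mul_assoc, ← mul_pow, ← h1, hEgf₀]; ring
    exact mul_left_cancel₀ (pow_ne_zero p (X_some_ne_zero i₀)) h2
  have hQ𝔪 : Q ∈ maximalIdeal (MvPowerSeries (Option (Fin n)) κ) := by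
    have h1 : E (ofL f') ∈ maximalIdeal (MvPowerSeries (Option (Fin n)) κ) := by
      refine ringEquiv_mem_maximalIdeal E ?_
      rw [AdicCompletion.maximalIdeal_eq_map]
      exact Ideal.mem_map_of_mem _ hf'𝔪
    have h2 : subst σ w₀ * Q ∈ maximalIdeal (MvPowerSeries (Option (Fin n)) κ) := by
      rw [← hEf']; exact Ideal.mul_mem_left _ _ h1
    exact (Ideal.unit_mul_mem_iff_mem _ hw₀').1 h2
  have hζr : ζ = constantCoeff r := by
    have h1 : constantCoeff Q = 0 := mem_maximalIdeal_iff_constantCoeff_eq_zero.1 hQ𝔪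
    rw [hQ, map_sub, map_pow, map_add, constantCoeff_X, zero_add, constantCoeff_C, constantCoeff_rename_some,
      sub_eq_zero, hT, ← constantCoeff_cleaningShift_pow c₀ i₀ τκ, ← hr] at h1
    exact frobenius_inj κ p h1
  -- STEP 5: the shear by `s = r − r(0)` and the atom identity
  set sh : MvPowerSeries (Option (Fin n)) κ :=
    rename (some : Fin n → Option (Fin n)) r - MvPowerSeries.C (constantCoeff r) with hsh
  obtain ⟨E', hE'C, hE'i, hE'j, hE'z⟩ :=
    exists_ringEquiv_completion_chart_shear g hg E₀ c hc hcX (some i₀) e he τ hgen hres hdim none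
      (Option.some_ne_none i₀).symm sh (constantCoeff_rename_sub_C r) (kill_rename_sub_C r)
  have hE'z' : E' (φ (X none)) = X (some i₀) * (X none + rename (some : Fin n → Option (Fin n)) r) := by
    rw [hE'z, hτ', hsh]
    change X (some i₀) * (X none + MvPowerSeries.C ζ + (rename some r - MvPowerSeries.C (constantCoeff r))) = _
    rw [hζr]
    ring
  have hE'j' : ∀ j : Fin n, j ≠ i₀ → E' (φ (X (some j))) = X (some i₀) * (X (some j) + MvPowerSeries.C (τκ j)) := by
    intro j hj
    rw [hE'j (some j) (fun h => hj (Option.some_injective _ h)) (Option.some_ne_none j), hτ']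
    rfl
  have hE'atom : E' (φ ((X none : MvPowerSeries (Option (Fin n)) κ) ^ p - rename (some : Fin n → Option (Fin n)) a₀)) =
      X (some i₀) ^ p * ((X none : MvPowerSeries (Option (Fin n)) κ) ^ p -
        rename (some : Fin n → Option (Fin n)) (ser p n κ (step p n κ i₀ τκ c₀))) := by
    have := ringHom_atom_eq ((E' : _ →+* MvPowerSeries (Option (Fin n)) κ).comp φ) hE'C c₀ i₀ τκ hM hE'i hE'j' hE'z'
    exact this
  -- `E′ ∘ φ` is the germ chart substitution, whose values are multiples of `X_i`
  set σ' : Option (Fin n) → MvPowerSeries (Option (Fin n)) κ := fun o => o.elim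
    (X (some i₀) * (X none + rename (some : Fin n → Option (Fin n)) r))
    (fun j => rename (some : Fin n → Option (Fin n)) (chartSubst n κ i₀ τκ j)) with hσ'
  have hσ'sub : HasSubst σ' := hasSubst_chartGerm i₀ τκ r
  have hE'φ : ∀ f, E' (φ f) = subst σ' f := fun f =>
    ringHom_eq_subst_chartGerm ((E' : _ →+* MvPowerSeries (Option (Fin n)) κ).comp φ) hE'C i₀ τκ r hE'i hE'j' hE'z' f
  have hσ'i : σ' (some i₀) = X (some i₀) := rename_chartSubst_self i₀ τκ
  have hσ'X : ∀ j, σ' j ∈ Ideal.span {(X (some i₀) : MvPowerSeries (Option (Fin n)) κ)} := by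
    intro j
    cases j with
    | none => exact Ideal.mul_mem_right _ _ (Ideal.subset_span rfl)
    | some k =>
      by_cases hk : k = i₀
      · subst hk; rw [hσ'i]; exact Ideal.subset_span rfl
      · change rename some (chartSubst n κ i₀ τκ k) ∈ _
        rw [rename_chartSubst_of_ne i₀ τκ hk]
        exact Ideal.mul_mem_right _ _ (Ideal.subset_span rfl)
  obtain ⟨w₂, hw₂, hE'ci⟩ : ∃ w₂ : MvPowerSeries (Option (Fin n)) κ, IsUnit w₂ ∧
      E' (ofL (g (c (some i₀)))) = X (some i₀) * w₂ := by
    obtain ⟨w₂, hw₂, h⟩ := exists_isUnit_image_adapted i₀ hσ'sub hσ'i hσ'X (E₀ (ofR (c (some i₀)))) (hcX (some i₀))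
    exact ⟨w₂, hw₂, by rw [← hĝ_of, ← hφE₀, hE'φ, h]⟩
  have hw₀'' : IsUnit (subst σ' w₀) := by rw [← substAlgHom_apply hσ'sub]; exact hw₀.map _
  -- STEP 6: `E′ f′ = unit · successor atom`
  have hfin : w₂ ^ p * E' (ofL f') = subst σ' w₀ * ((X none : MvPowerSeries (Option (Fin n)) κ) ^ p -
      rename (some : Fin n → Option (Fin n)) (ser p n κ (step p n κ i₀ τκ c₀))) := by
    have h1 : E' (ofL (g f₀)) = (X (some i₀) * w₂) ^ p * E' (ofL f') := by
      rw [hf', map_mul, map_pow, map_mul, map_pow, hE'ci]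
    have h0 : E' (ofL (g f₀)) = subst σ' w₀ * (X (some i₀) ^ p * ((X none : MvPowerSeries (Option (Fin n)) κ) ^ p -
        rename (some : Fin n → Option (Fin n)) (ser p n κ (step p n κ i₀ τκ c₀)))) := by
      rw [← hĝ_of, ← hφE₀, hf₀, map_mul, map_mul, hE'atom, hE'φ]
    have h2 : (X (some i₀) : MvPowerSeries (Option (Fin n)) κ) ^ p * (w₂ ^ p * E' (ofL f')) =
        X (some i₀) ^ p * (subst σ' w₀ * ((X none : MvPowerSeries (Option (Fin n)) κ) ^ p -
          rename (some : Fin n → Option (Fin n)) (ser p n κ (step p n κ i₀ τκ c₀)))) := by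
      rw [← mul_assoc, ← mul_pow, ← h1, h0]; ring
    exact mul_left_cancel₀ (pow_ne_zero p (X_some_ne_zero i₀)) h2
  obtain ⟨u₂, hu₂⟩ := (hw₂.pow p)
  refine ⟨E', ↑u₂⁻¹ * subst σ' w₀, (u₂⁻¹.isUnit).mul hw₀'', hE'C, ?_⟩
  rw [mul_assoc, ← hfin, ← hu₂, ← mul_assoc, Units.inv_mul, one_mul]

end Transform

end CampaignW46.AtomGerm

end Summit.ResolutionOfSingularities.ResolutionOfSingularities.Theorems

end
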